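import Literature.MathematicalPhysics.QuantumFieldTheory.Balaban1983to89.B9Thm312WholeLeaf

/-!
# `Balaban1983to89.B9Thm312WholeStepRegular` — [B9] Theorem 3.12 (3.130)∕(3.138), THE PERTURBATION STEP OVER A REGULAR STATE CLASS: the schemas `Step` and
# `Letters3131` of rows 20–21 with the raw state norm 𝔠⁽ᵖ⁾ REPLACED BY A FREE BLOCK NORM 𝔖 (print: the induction runs «in all norms (3.42)–(3.47)», p. 422),
# the step from the letters by two compositions, and the resolvent bootstrap `hasMaj_right_of_stepS` (generic in 𝔖) — LOCATED-U8's cure at the step level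

T. Bałaban, *Propagators for lattice gauge theories in a background field*, Commun. Math. Phys. **99** (1985) 389–434 [`Balaban1985BackgroundPropagators`,
"B9"]; [4] = T. Bałaban, *Propagators and renormalization transformations for lattice gauge theories. II*, Commun. Math. Phys. **96** (1984) 223–250
[`Balaban1984PropagatorsII`].  statement-level skeleton of published theorems with citation tags; proofs where landed; nothing here is a claim about the
Yang–Mills mass gap.  Sequel of `B9Thm312Whole` (`Step`), `B9Thm312WholeStepFrom3131` (`Letters3131`, `step_of_letters3131`), `B9Thm312WholeLeaf` (`hasMaj_right_of_step`).

THE PRINT.  p. 421–422: *"G = G₀(I − Δ′_πG₀)⁻¹ = Σ G₀(Δ′_πG₀)ⁿ (3.130) … This inequality and Theorem 3.3 for G₀ imply a convergence of the series (3.130), for α₀ sufficiently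
small, in all norms appearing on the left-hand sides of the inequalities (3.42)–(3.47)"*; p. 423: *"G₁ = Σ G₀((Δ′_π + Δ⁽²⁾_π)G₀)ⁿ (3.138). Estimates of the terms in this series are
now a little bit more complicated … we have derivatives in the operator Δ′_π + Δ⁽²⁾_π which have to be applied either to the operator on the right, or on the left, because
kernels of the operators defining Δ′_π + Δ⁽²⁾_π are not regular enough"*; (3.44) p. 398.

THE POINT (dag-n06-l LOCATED-U8, `DELTA2-LETTERS-MEMO.md` §5).  `B9Thm312Whole.Step 𝔬 … p θ δK U` asks `G₀(Δ′_π + Δ⁽²⁾_π)` to be small on the RAW sup class 𝔠⁽ᵖ⁾ — for its Δ⁽²⁾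
half not print's statement (the right factor 1 − D_UG′RD\*_U of (3.135) is an order-zero singular-integral word on a raw input).  Print's induction state carries the
regularity of the G₀-outputs; on such a state class 𝔖 the one-sided letters T_a₂ = Δ⁽²⁾π, T_b₂ = −RG′D\*_UT_a₂ ARE printed species (the sandwich's (3.44) member of 𝔖 —
`B9PerturbationMajorant2Letters.maj_ta2_of_src`, at node00-def-Y's pins `B9Thm313WholeDelta2LettersAtStatePrint`).  THIS FILE re-types the step layer with the state norm FREE:
* §1 `StepS 𝔬 𝔖 θ δK U` — `Step`'s two fields with `cNorm … p ↦ 𝔖`; `LettersS3131 𝔬 Ta Ta₂ Tb Tb₂ … 𝔖 bH t δT U` — `Letters3131`'s splits and the four letters OUT OF 𝔖: `ta, ta₂ :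
  𝔖 → 𝔠⁽⁰⁾` and `tbH, tb₂H : 𝔖 → bH` (bH free: the sup class `cNorm blkW 1` for the sup step, where G₀D_U is Theorem 3.3's (3.42)₃ word; a Hölder class for the D-left steps);
* §2 ★★ `stepS_of_lettersS` — `StepS` from `LettersS3131`, `G₀ : 𝔠⁽⁰⁾ → 𝔖` (Theorem 3.3 (3.42)₁,₂ read INTO the state class) and `G₀D_U : bH → 𝔖` ((3.42)₃ + (3.43) for G₀), by
  TWO compositions ([4] (2.54) + Lemma 2.1 (2.61); the intermediate classes cut at cost `1` and `bH.κ`) — `step_of_letters3131` verbatim with the classes freed;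
* §3 ★★ `hasMaj_right_of_stepS` — the resolvent bootstrap `A = G₀ + G₀TA ⟹ A∘F : b₀ → 𝔖` with `A_S(1 − 𝔖.κθc)⁻¹e^{−ρd}` (`B9SectDSup.rightEntry_majorant`, already generic in the
  state block norm; the a-priori majorant `hap` stays a hypothesis here), and `hasMaj_read_of_state` (any reading `id : 𝔖 → b₂` turns a right entry INTO 𝔖 into the entry
  INTO `b₂` — how every consumer of `hK` in `B9Thm313Whole*` recovers its present `cNorm`-conclusions from the regular state); ★ `exists_hasMaj_const_of_dom` (the a-priori
  majorant `hap` for any state class dominated by the global ℓ¹ size — the finite-dimensional remark behind [4] (2.66)).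
HONEST SCOPE.  Hypothesis schemas + bookkeeping over free block maps, free letters and a free state class; nothing of [B9]∕[4] asserted; no pin, no certificate edit;
COUNT-NEUTRAL; N06 NOT discharged; one finite lattice at a time — nothing continuum ∕ OS ∕ mass gap.  Cell `pub-ymgap` (HUMAN RULING D-0062), Track A node N06 [B9], bundle
F7 rows 20–21, seat `pub-ymgap-dag-n06-l` (g26), 2026-08-29.  NEW file; nothing landed is modified.
-/

namespace Literature.MathematicalPhysics.QuantumFieldTheory.Balaban1983to89.B9Thm312WholeStepRegular

open Literature.MathematicalPhysics.QuantumFieldTheory.Balaban1983to89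
open Finset B6RandomWalk B6RandomWalkHom B9Thm34Ext B11SectG B9SectDSup B9Thm312Whole B9Thm312WholeLeaf

noncomputable section

variable {g : B9.Geometry} {B : B9.Backgrounds} {X Y Z W : Type}
variable [Fintype X] [Fintype W] [Fintype g.Site]
variable {R₀ : ℝ} {H₀ : Prop}

/-! ## §1 The step and the letters over a free state class -/

/-- **THE PERTURBATION STEPS OF (3.130) AND (3.138) OVER A REGULAR STATE CLASS 𝔖**: K′ = G₀Δ′_π and K′₁ = G₀(Δ′_π + Δ⁽²⁾_π) have the block majorant θ·e^{−δ_K d} ON 𝔖 — the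
schema `B9Thm312Whole.Step` with the raw state norm 𝔠⁽ᵖ⁾ replaced by a free block norm (print p. 422: the convergence of (3.130)∕(3.138) holds «in all norms appearing on the
left-hand sides of (3.42)–(3.47)», i.e. on a state carrying the regularity of the G₀-outputs).  A HYPOTHESIS SCHEMA; §2 derives it from the letters.
[cite: Balaban1985BackgroundPropagators, (3.130)–(3.131) pp.421–422 + (3.137)–(3.138) p.423] -/
structure StepS (𝔬 : Ops g B X Y Z W) (𝔖 : BlockNorm (toB6 g R₀ H₀) (X → ℝ)) (θ δK : ℝ) (U : B.Cfg) : Prop where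
  step : HasMaj 𝔖 𝔖 (𝔬.G0 U ∘ₗ 𝔬.Tpi U) (fun a b => θ * Real.exp (-(δK * g.dist a b)))
  step1 : HasMaj 𝔖 𝔖 (𝔬.G0 U ∘ₗ (𝔬.Tpi U + 𝔬.T2 U)) (fun a b => θ * Real.exp (-(δK * g.dist a b)))

/-- **THE (3.131) ∕ (3.137) LETTERS OUT OF A REGULAR STATE CLASS**: Δ′_π = T_a + D_U·T_b (`split`), Δ⁽²⁾_π = T_a₂ + D_U·T_b₂ (`split₂`) with T_a, T_a₂ : 𝔖 → 𝔠⁽⁰⁾ and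
T_b, T_b₂ : 𝔖 → bH, bH = whatever class the entry G₀D_U is read OUT OF (the sup class 𝔠_W⁽¹⁾ for the sup step — then `tbH tb₂H` are `Letters3131`'s `tb tb₂` with the
source freed; the Hölder class of the D-left steps otherwise — then they are `Letters3131H`'s fields), all four with the small block majorant t·e^{−δ_T d}.  On 𝔖 = a class carrying the (3.44) member of D_UG′D\*_U the Δ⁽²⁾ fields are printed species (LOCATED-U8).
A HYPOTHESIS SCHEMA over FREE letters. [cite: Balaban1985BackgroundPropagators, (3.130)–(3.131) pp.421–422 + (3.135)–(3.137) pp.422–423 + (3.44) p.398] -/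
structure LettersS3131 (𝔬 : Ops g B X Y Z W) (Ta Ta₂ : B.Cfg → Module.End ℝ (X → ℝ)) (Tb Tb₂ : B.Cfg → (X → ℝ) →ₗ[ℝ] (W → ℝ))
    (R₀ : ℝ) (H₀ : Prop) (hlen : ∀ y : g.Site, 0 ≤ g.len y) (𝔖 : BlockNorm (toB6 g R₀ H₀) (X → ℝ)) (bH : BlockNorm (toB6 g R₀ H₀) (W → ℝ))
    (t δT : ℝ) (U : B.Cfg) : Prop where
  split : 𝔬.Tpi U = Ta U + 𝔬.Dv U ∘ₗ Tb U
  split₂ : 𝔬.T2 U = Ta₂ U + 𝔬.Dv U ∘ₗ Tb₂ U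
  ta : HasMaj 𝔖 (cNorm R₀ H₀ 𝔬.blk hlen 0) (Ta U) (fun a b => t * Real.exp (-(δT * g.dist a b)))
  ta₂ : HasMaj 𝔖 (cNorm R₀ H₀ 𝔬.blk hlen 0) (Ta₂ U) (fun a b => t * Real.exp (-(δT * g.dist a b)))
  tbH : HasMaj 𝔖 bH (Tb U) (fun a b => t * Real.exp (-(δT * g.dist a b)))
  tb₂H : HasMaj 𝔖 bH (Tb₂ U) (fun a b => t * Real.exp (-(δT * g.dist a b)))

/-! ## §2 The step from the letters: two compositions -/

omit [Fintype X] [Fintype W] [Fintype g.Site] in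
/-- Kernel monotonicity. [folklore] -/
private theorem kernel_le {C θ r δK d : ℝ} (hC : 0 ≤ C) (hCθ : C ≤ θ) (hδK : δK ≤ r) (hd : 0 ≤ d) :
    C * Real.exp (-(r * d)) ≤ θ * Real.exp (-(δK * d)) :=
  calc C * Real.exp (-(r * d)) ≤ C * Real.exp (-(δK * d)) :=
      mul_le_mul_of_nonneg_left (Real.exp_le_exp.mpr (neg_le_neg (mul_le_mul_of_nonneg_right hδK hd))) hC
    _ ≤ θ * Real.exp (-(δK * d)) := mul_le_mul_of_nonneg_right hCθ (Real.exp_nonneg _)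

omit [Fintype W] in
/-- **ONE COMPOSITION OVER THE STATE CLASS — G₀T FOR A SPLIT T = T_a + D_U·T_b**: G₀ : 𝔠⁽⁰⁾ → 𝔖 (B₀), G₀D_U : bH → 𝔖 (B₃), T_a : 𝔖 → 𝔠⁽⁰⁾, T_b : 𝔖 → bH (t) ⟹
G₀T = G₀T_a + (G₀D_U)T_b : 𝔖 → 𝔖 with (B₀ + bH.κ·B₃)·t·c·e^{−ρd} (ρ ≦ δ_T, ρ + σ ≦ min(δ₀, δ₃); the sharp class 𝔠⁽⁰⁾ cuts at cost 1, bH at cost bH.κ).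
[cite: Balaban1985BackgroundPropagators, (3.130)–(3.131) pp.421–422; Balaban1984PropagatorsII, (2.52)–(2.56) pp.232–233 + Lemma 2.1 (2.61) p.234] -/
theorem hasMaj_G0_comp_splitS (hG : GeoOK g) {blk : X → g.Site} {𝔖 : BlockNorm (toB6 g R₀ H₀) (X → ℝ)} {bH : BlockNorm (toB6 g R₀ H₀) (W → ℝ)}
    {G0 T Ta : Module.End ℝ (X → ℝ)} {Dv : (W → ℝ) →ₗ[ℝ] (X → ℝ)} {Tb : (X → ℝ) →ₗ[ℝ] (W → ℝ)}
    {B₀ B₃ t δ₀ δ₃ δT ρ σ c : ℝ} (hrow : RowSum (toB6 g R₀ H₀) σ c)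
    (hB₀ : 0 ≤ B₀) (hB₃ : 0 ≤ B₃) (ht : 0 ≤ t) (hρ : 0 ≤ ρ) (hρT : ρ ≤ δT) (hρ₀ : ρ + σ ≤ δ₀) (hρ₃ : ρ + σ ≤ δ₃)
    (hsplit : T = Ta + Dv ∘ₗ Tb)
    (hG0 : HasMaj (cNorm R₀ H₀ blk hG.lenle 0) 𝔖 G0 (fun a b => B₀ * Real.exp (-(δ₀ * g.dist a b))))
    (hGD : HasMaj bH 𝔖 (G0 ∘ₗ Dv) (fun a b => B₃ * Real.exp (-(δ₃ * g.dist a b))))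
    (hta : HasMaj 𝔖 (cNorm R₀ H₀ blk hG.lenle 0) Ta (fun a b => t * Real.exp (-(δT * g.dist a b))))
    (htb : HasMaj 𝔖 bH Tb (fun a b => t * Real.exp (-(δT * g.dist a b)))) :
    HasMaj 𝔖 𝔖 (G0 ∘ₗ T) (fun a b => (B₀ + bH.κ * B₃) * t * c * Real.exp (-(ρ * g.dist a b))) := by
  have htri : Triangle254 (toB6 g R₀ H₀) := fun a b c => hG.tri a b c
  have h1 := hasMaj_comp_exp htri hG.dnn hrow hB₀ ht hρ hρT hρ₀ hG0 hta
  have h2 := hasMaj_comp_exp htri hG.dnn hrow hB₃ ht hρ hρT hρ₃ hGD htb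
  have hsum := h1.add h2
  refine (hsum.congr fun μ => ?_).mono fun a b => le_of_eq ?_
  · rw [hsplit]
    simp only [LinearMap.add_apply, LinearMap.comp_apply, map_add]
  · simp only [cNorm_κ, toB6_dist]
    ring

omit [Fintype W] in
/-- ★★ **THE STEP OVER THE STATE CLASS FROM THE LETTERS**: `StepS 𝔬 𝔖 θ δK U` from `LettersS3131`, the entries `G₀ : 𝔠⁽⁰⁾ → 𝔖` (B₀e^{−δ₀d}) and `G₀D_U : bH → 𝔖` (B₃e^{−δ₃d}),
for every θ ≧ 2(B₀ + bH.κ·B₃)·t·c and δ_K ≦ ρ (0 ≦ ρ ≦ δ_T, ρ + σ ≦ min(δ₀, δ₃)).  θ is O(1)·Mα₀ in print (*"each operator Δ′_π provides the small factor α₀"*).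
[cite: Balaban1985BackgroundPropagators, Thm 3.12 p.423 + (3.130)–(3.131) pp.421–422 + (3.137)–(3.138) p.423 + Thm 3.3 p.399; Balaban1984PropagatorsII, (2.54) p.233 + Lemma 2.1 (2.61) p.234] -/
theorem stepS_of_lettersS (hG : GeoOK g) {𝔬 : Ops g B X Y Z W} {Ta Ta₂ : B.Cfg → Module.End ℝ (X → ℝ)}
    {Tb Tb₂ : B.Cfg → (X → ℝ) →ₗ[ℝ] (W → ℝ)} {𝔖 : BlockNorm (toB6 g R₀ H₀) (X → ℝ)} {bH : BlockNorm (toB6 g R₀ H₀) (W → ℝ)} {U : B.Cfg}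
    {B₀ B₃ t δ₀ δ₃ δT ρ σ c θ δK : ℝ}
    (hrow : RowSum (toB6 g R₀ H₀) σ c) (hc : 0 ≤ c) (hB₀ : 0 ≤ B₀) (hB₃ : 0 ≤ B₃) (ht : 0 ≤ t) (hρ : 0 ≤ ρ) (hρT : ρ ≤ δT)
    (hρ₀ : ρ + σ ≤ δ₀) (hρ₃ : ρ + σ ≤ δ₃) (hθ : 2 * ((B₀ + bH.κ * B₃) * t * c) ≤ θ) (hδK : δK ≤ ρ)
    (hG0 : HasMaj (cNorm R₀ H₀ 𝔬.blk hG.lenle 0) 𝔖 (𝔬.G0 U) (fun a b => B₀ * Real.exp (-(δ₀ * g.dist a b))))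
    (hGD : HasMaj bH 𝔖 (𝔬.G0 U ∘ₗ 𝔬.Dv U) (fun a b => B₃ * Real.exp (-(δ₃ * g.dist a b))))
    (hL : LettersS3131 𝔬 Ta Ta₂ Tb Tb₂ R₀ H₀ hG.lenle 𝔖 bH t δT U) :
    StepS 𝔬 𝔖 θ δK U := by
  have hA := hasMaj_G0_comp_splitS hG hrow hB₀ hB₃ ht hρ hρT hρ₀ hρ₃ hL.split hG0 hGD hL.ta hL.tbH
  have hB := hasMaj_G0_comp_splitS hG hrow hB₀ hB₃ ht hρ hρT hρ₀ hρ₃ hL.split₂ hG0 hGD hL.ta₂ hL.tb₂H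
  have hK : 0 ≤ (B₀ + bH.κ * B₃) * t * c := mul_nonneg (mul_nonneg (add_nonneg hB₀ (mul_nonneg bH.κ_nonneg hB₃)) ht) hc
  have hc2 : (B₀ + bH.κ * B₃) * t * c ≤ θ := by linarith
  refine ⟨?_, ?_⟩
  · exact hA.mono fun a b => kernel_le hK hc2 hδK (hG.dnn a b)
  · refine ((hA.add hB).congr fun μ => ?_).mono fun a b => ?_
    · simp only [LinearMap.add_apply, LinearMap.comp_apply, map_add]
    · have h := kernel_le (mul_nonneg (by norm_num) hK) hθ hδK (hG.dnn a b)
      refine le_trans (le_of_eq ?_) h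
      ring

/-! ## §3 The resolvent bootstrap over the state class and the readings of its right entries -/

omit [Fintype X] [Fintype W] in
/-- ★★ **THE RIGHT ENTRIES OF G (OR G₁) OVER THE STATE CLASS**: `A = G₀ + G₀TA` (the resolvent identity of (3.130)∕(3.138), `fix_of_inverses`), the step `G₀T : 𝔖 → 𝔖`
(θe^{−δ_K d}), an entry `G₀F : b₀ → 𝔖` (A_Se^{−ρ_S d}), an a-priori majorant of `AF` and `q = 𝔖.κ·θ·c < 1` ⟹ `AF : b₀ → 𝔖` with `A_S(1 − q)⁻¹e^{−ρd}` (ρ ≦ ρ_S, ρ + σ ≦ δ_K) —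
`B9SectDSup.rightEntry_majorant` (generic in the state block norm) in this vocabulary. [cite: Balaban1985BackgroundPropagators, (3.130) p.421 + (3.138) p.423 + Thm 3.12 p.423; Balaban1984PropagatorsII, Lemma 2.1 p.234] -/
theorem hasMaj_right_of_stepS (hG : GeoOK g) {F₀ : Type} [AddCommGroup F₀] [Module ℝ F₀] {b₀ : BlockNorm (toB6 g R₀ H₀) F₀}
    {𝔖 : BlockNorm (toB6 g R₀ H₀) (X → ℝ)} {G0 T A : Module.End ℝ (X → ℝ)} {Fop : F₀ →ₗ[ℝ] (X → ℝ)} {θ Aₛ M₀ δK ρS ρ σ c : ℝ}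
    (hrow : RowSum (toB6 g R₀ H₀) σ c) (hθ : 0 ≤ θ) (hA : 0 ≤ Aₛ) (hM₀ : 0 ≤ M₀) (hρ : 0 ≤ ρ) (hρS : ρ ≤ ρS) (hρδ : ρ + σ ≤ δK)
    (hK : HasMaj 𝔖 𝔖 (G0 ∘ₗ T) (fun a b => θ * Real.exp (-(δK * g.dist a b))))
    (hS : HasMaj b₀ 𝔖 (G0 ∘ₗ Fop) (fun a b => Aₛ * Real.exp (-(ρS * g.dist a b))))
    (hfix : A = G0 + G0 ∘ₗ T ∘ₗ A) (hap : HasMaj b₀ 𝔖 (A ∘ₗ Fop) (fun _ _ => M₀)) (hq : 𝔖.κ * θ * c < 1) :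
    HasMaj b₀ 𝔖 (A ∘ₗ Fop) (fun a b => Aₛ * (1 - 𝔖.κ * θ * c)⁻¹ * Real.exp (-(ρ * g.dist a b))) := by
  have htri : Triangle254 (toB6 g R₀ H₀) := fun a b c => hG.tri a b c
  have h := B9SectDSup.rightEntry_majorant (g := toB6 g R₀ H₀) (𝒢 := G0) (𝒯 := T) htri hG.dnn hrow hθ hA hM₀ hρ hρS hρδ hK hS hfix hap hq
  simpa only [toB6_dist] using h

omit [Fintype X] [Fintype W] in
/-- ★★ **READING A RIGHT ENTRY OUT OF THE STATE CLASS**: an entry `AF : b₀ → 𝔖` (A_Se^{−ρ_S d}) followed by ANY reading `id : 𝔖 → b₂` (C_Re^{−r_R d}; e.g. the sup channel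
`𝔖₂ → 𝔠^{(−2)}` of `B9SmoothHolderClassState.hasMaj_id_state`, or its (3.44) channel) is the entry `AF : b₀ → b₂` with `𝔖.κ·C_R·A_S·c·e^{−ρd}` (ρ ≦ ρ_S, ρ + σ ≦ r_R) — how the
consumers of `hK` recover their `cNorm`-valued right entries. [cite: Balaban1985BackgroundPropagators, Thm 3.12 p.423 + (3.42) p.397; Balaban1984PropagatorsII, (2.52)–(2.56) pp.232–233 + (2.61) p.234] -/
theorem hasMaj_read_of_state (hG : GeoOK g) {F₀ F₂ : Type} [AddCommGroup F₀] [Module ℝ F₀] [AddCommGroup F₂] [Module ℝ F₂]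
    {b₀ : BlockNorm (toB6 g R₀ H₀) F₀} {𝔖 : BlockNorm (toB6 g R₀ H₀) (X → ℝ)} {b₂ : BlockNorm (toB6 g R₀ H₀) F₂}
    {E : F₀ →ₗ[ℝ] (X → ℝ)} {Rd : (X → ℝ) →ₗ[ℝ] F₂} {Aₛ ρS CR rR ρ σ c : ℝ}
    (hrow : RowSum (toB6 g R₀ H₀) σ c) (hA : 0 ≤ Aₛ) (hCR : 0 ≤ CR) (hρ : 0 ≤ ρ) (hρS : ρ ≤ ρS) (hρR : ρ + σ ≤ rR)
    (hE : HasMaj b₀ 𝔖 E (fun a b => Aₛ * Real.exp (-(ρS * g.dist a b))))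
    (hRd : HasMaj 𝔖 b₂ Rd (fun a b => CR * Real.exp (-(rR * g.dist a b)))) :
    HasMaj b₀ b₂ (Rd ∘ₗ E) (fun a b => 𝔖.κ * CR * Aₛ * c * Real.exp (-(ρ * g.dist a b))) := by
  have htri : Triangle254 (toB6 g R₀ H₀) := fun a b c => hG.tri a b c
  have h := hasMaj_comp_exp htri hG.dnn hrow hCR hA hρ hρS hρR hRd hE
  simpa only [toB6_dist] using h

omit [Fintype W] in
/-- ★ **THE A-PRIORI MAJORANT FOR A DOMINATED STATE CLASS** (the `hap` of `hasMaj_right_of_stepS`): if the state class's local sizes are dominated by the global ℓ¹ size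
(`loc y F ≤ Λ·Σ_z |F z|` — true for every class built from finitely many weighted sups of values and transported pair differences on a finite carrier, e.g. the regular state
`(Lʲη)⁻¹·bHZKPG` of `B9SmoothHolderClassState` under unitary-like transporters), then every operator out of a sharp state norm `𝔠_V^{(q)}` has SOME constant majorant into it.
[cite: Balaban1984PropagatorsII, (2.66) p.234 («the representation (2.50) is convergent in the norms»), bookkeeping; Balaban1985BackgroundPropagators, Thm 3.12 p.423] -/
theorem exists_hasMaj_const_of_dom (hG : GeoOK g) {V : Type} [Fintype V] (blkV : V → g.Site) (blk : X → g.Site) (q : ℕ)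
    {𝔖 : BlockNorm (toB6 g R₀ H₀) (X → ℝ)} {Λ : ℝ} (hΛ : 0 ≤ Λ) (hdom : ∀ (y : g.Site) (F : X → ℝ), 𝔖.loc y F ≤ Λ * ∑ x : X, |F x|)
    (T : (V → ℝ) →ₗ[ℝ] (X → ℝ)) :
    ∃ M₀ : ℝ, 0 ≤ M₀ ∧ HasMaj (cNorm R₀ H₀ blkV hG.lenle q) 𝔖 T (fun _ _ => M₀) := by
  classical
  obtain ⟨M, hM, h⟩ := B9Thm37AllNorms.exists_hasMaj_const_ofBlocks (G := toB6 g R₀ H₀) blkV blk T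
  set Lq : ℝ := ∑ y : g.Site, g.len y ^ q with hLq
  have hLq0 : 0 ≤ Lq := Finset.sum_nonneg fun y _ => pow_nonneg (hG.lenle y) q
  refine ⟨Λ * ((Fintype.card X : ℝ) * M) * Lq, mul_nonneg (mul_nonneg hΛ (mul_nonneg (Nat.cast_nonneg _) hM)) hLq0, ?_⟩
  intro y' μ hμ y
  set B : ℝ := (BlockNorm.ofBlocks (toB6 g R₀ H₀) blkV).loc y' μ with hB
  have hB0 : 0 ≤ B := BlockNorm.loc_nonneg _ _ _
  -- every value of `Tμ` is below `M·B`
  have hval : ∀ x : X, |T μ x| ≤ M * B := fun x =>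
    (B9Thm37AllNormsInstances.abs_apply_le_ofBlocks_loc (G := toB6 g R₀ H₀) blk (blk x) (T μ) x rfl).trans (h y' μ hμ (blk x))
  have hsum : ∑ x : X, |T μ x| ≤ (Fintype.card X : ℝ) * M * B := by
    calc ∑ x : X, |T μ x| ≤ ∑ _x : X, M * B := Finset.sum_le_sum fun x _ => hval x
      _ = (Fintype.card X : ℝ) * M * B := by rw [Finset.sum_const, Finset.card_univ, nsmul_eq_mul]; ring
  -- the sharp size in terms of the state norm: `B = (Lʲ′η)^q · loc_{𝔠^{(q)}} ≤ Lq · loc`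
  have hloc : (cNorm R₀ H₀ blkV hG.lenle q).loc y' μ = wt g q y' * B := rfl
  have hlen : 0 < g.len y' ^ q := pow_pos (hG.lenpos y') q
  have hBq : B = g.len y' ^ q * (cNorm R₀ H₀ blkV hG.lenle q).loc y' μ := by
    rw [hloc, wt, ← mul_assoc, mul_inv_cancel₀ hlen.ne', one_mul]
  have h2 : g.len y' ^ q ≤ Lq := Finset.single_le_sum (fun z _ => pow_nonneg (hG.lenle z) q) (Finset.mem_univ y')
  have hl0 : 0 ≤ (cNorm R₀ H₀ blkV hG.lenle q).loc y' μ := BlockNorm.loc_nonneg _ _ _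
  calc 𝔖.loc y (T μ) ≤ Λ * ∑ x : X, |T μ x| := hdom y (T μ)
    _ ≤ Λ * ((Fintype.card X : ℝ) * M * B) := mul_le_mul_of_nonneg_left hsum hΛ
    _ = Λ * ((Fintype.card X : ℝ) * M) * (g.len y' ^ q * (cNorm R₀ H₀ blkV hG.lenle q).loc y' μ) := by rw [hBq]; ring
    _ ≤ Λ * ((Fintype.card X : ℝ) * M) * (Lq * (cNorm R₀ H₀ blkV hG.lenle q).loc y' μ) :=
        mul_le_mul_of_nonneg_left (mul_le_mul_of_nonneg_right h2 hl0) (mul_nonneg hΛ (mul_nonneg (Nat.cast_nonneg _) hM))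
    _ = Λ * ((Fintype.card X : ℝ) * M) * Lq * (cNorm R₀ H₀ blkV hG.lenle q).loc y' μ := by ring

end

end Literature.MathematicalPhysics.QuantumFieldTheory.Balaban1983to89.B9Thm312WholeStepRegular
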